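import Summits.NavierStokesRegularity.NavierStokesRegularity.Theorems.ApexLocalisation.Negative.LogicAndLoadBearing
import Literature.Analysis.FluidPDE.LocalTypeICongr

/-!
# `ApexLocalisation` (crux stmt-NavierStokesRegularity-11719): the a.e. form of the crux —
# negative-side support (cdisprove seat, gen 2)

Companion of `Negative/LogicAndLoadBearing.lean`. The route file states the Type-I bounds
POINTWISE (`HasTypeITimeDecay`, `HasTypeIDecay`), while every other conjunct of the two classes is
an a.e./integral notion and compactness arguments (Albritton–Barker Lemma 2.2 / Prop. 2.3) deliver
a.e.-defined limits. Using the landed representatives of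
`Literature/Analysis/FluidPDE/LocalTypeICongr.lean` (`exists_rate_profile_repr`,
`exists_apex_profile_repr`), this file proves that nothing is lost:

* `AERateProfileExists`, `AEApexProfileExists` — the two existence statements with the bounds
  only a.e. on the slab (constant `C ≥ 0`);
* `rateProfileExists_iff_ae`, `apexProfileExists_iff_ae`;
* `apexLocalisation_iff_ae : ApexLocalisation ↔ (AERateProfileExists → AEApexProfileExists)`.

## References

* D. Albritton, T. Barker, J. Math. Fluid Mech. 21 (2019) = arXiv:1811.00502, §1–§2. [AlbrittonBarker2019]
* L. Caffarelli, R. Kohn, L. Nirenberg, CPAM 35 (1982), §2. [CaffarelliKohnNirenberg1982]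
-/

noncomputable section

open MeasureTheory TopologicalSpace Set Function Filter Topology Metric
open scoped InnerProductSpace RealInnerProductSpace ENNReal NNReal
open Literature.Analysis.FluidPDE
open Summit.NavierStokesRegularity.NavierStokesRegularity.Theses

set_option linter.dupNamespace false

namespace Summit.NavierStokesRegularity.NavierStokesRegularity.Theorems.ApexLocalisation.Negative

/-- Physical space. -/
local notation "ℝ³" => EuclideanSpace ℝ (Fin 3)

/-- The open backward slab. -/
local notation "𝕊" => Literature.Analysis.FluidPDE.slab (EuclideanSpace ℝ (Fin 3)) (Set.Iio (0 : ℝ)) isOpen_Iio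

/-- The antecedent class with the rate stated only ALMOST EVERYWHERE on the slab (the form a
compactness argument delivers), constant `C ≥ 0`. -/
def AERateProfileExists : Prop :=
  ∃ (C : ℝ) (u : ℝ → ℝ³ → ℝ³) (p : ℝ → ℝ³ → ℝ) (G : ℝ → ℝ³ → ℝ³ →L[ℝ] ℝ³), 0 ≤ C ∧
    IsSuitableWeakSolutionOn 𝕊 1 0 u p ∧ HasWeakSpatialGradientOn 𝕊 u G ∧
      typeIBound (Set.Iio (0 : ℝ) ×ˢ Set.univ) u p G < ⊤ ∧
        (∀ᵐ w ∂(volume.restrict (Set.Iio (0 : ℝ) ×ˢ (Set.univ : Set ℝ³))),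
          ‖u w.1 w.2‖ ≤ C / Real.sqrt (-w.1)) ∧
          IsBackwardSingularPoint u 0

/-- The conclusion class with the apex bound stated only almost everywhere. -/
def AEApexProfileExists : Prop :=
  ∃ (C : ℝ) (u : ℝ → ℝ³ → ℝ³) (p : ℝ → ℝ³ → ℝ) (G : ℝ → ℝ³ → ℝ³ →L[ℝ] ℝ³), 0 ≤ C ∧
    IsSuitableWeakSolutionOn 𝕊 1 0 u p ∧ HasWeakSpatialGradientOn 𝕊 u G ∧
      typeIBound (Set.Iio (0 : ℝ) ×ˢ Set.univ) u p G < ⊤ ∧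
        (∀ᵐ w ∂(volume.restrict (Set.Iio (0 : ℝ) ×ˢ (Set.univ : Set ℝ³))),
          ‖u w.1 w.2‖ ≤ C / (‖w.2‖ + Real.sqrt (-w.1))) ∧
          IsBackwardSingularPoint u 0

/-- Pointwise ⇔ a.e. for the antecedent class (representatives: `exists_rate_profile_repr`). -/
theorem rateProfileExists_iff_ae : RateProfileExists ↔ AERateProfileExists := by
  constructor
  · rintro ⟨C, u, p, G, h⟩
    refine ⟨C, u, p, G, h.pos.le, h.1, h.2.1, h.2.2.1, ?_, h.2.2.2.2⟩
    refine (ae_restrict_iff' (measurableSet_Iio.prod MeasurableSet.univ)).2 (ae_of_all _ ?_)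
    rintro ⟨t, x⟩ ⟨ht, -⟩
    exact h.2.2.2.1 t ht x
  · rintro ⟨C, u, p, G, hC, hs, hg, hI, hae, hsing⟩
    obtain ⟨u', -, hs', hg', hI', hd', hsing'⟩ := exists_rate_profile_repr hC hs hg hI hsing hae
    exact ⟨C, u', p, G, hs', hg', hI', hd', hsing'⟩

/-- Pointwise ⇔ a.e. for the conclusion class (representatives: `exists_apex_profile_repr`). -/
theorem apexProfileExists_iff_ae : ApexProfileExists ↔ AEApexProfileExists := by
  constructor
  · rintro ⟨C, u, p, G, h⟩
    refine ⟨C, u, p, G, h.pos.le, h.1, h.2.1, h.2.2.1, ?_, h.2.2.2.2⟩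
    refine (ae_restrict_iff' (measurableSet_Iio.prod MeasurableSet.univ)).2 (ae_of_all _ ?_)
    rintro ⟨t, x⟩ ⟨ht, -⟩
    exact h.2.2.2.1 t ht x
  · rintro ⟨C, u, p, G, hC, hs, hg, hI, hae, hsing⟩
    obtain ⟨u', -, hs', hg', hI', hd', hsing'⟩ := exists_apex_profile_repr hC hs hg hI hsing hae
    exact ⟨C, u', p, G, hs', hg', hI', hd', hsing'⟩

/-- **The a.e. form of the crux**: `ApexLocalisation ↔ (AERateProfileExists → AEApexProfileExists)`.
A prover may work entirely with a.e.-defined objects (limits of A–B compactness) on both sides; the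
pointwise `HasTypeITimeDecay` / `HasTypeIDecay` of the route file cost nothing. -/
theorem apexLocalisation_iff_ae :
    RellichScar.ApexLocalisation ↔ (AERateProfileExists → AEApexProfileExists) := by
  rw [apexLocalisation_iff, rateProfileExists_iff_ae, apexProfileExists_iff_ae]

end Summit.NavierStokesRegularity.NavierStokesRegularity.Theorems.ApexLocalisation.Negative
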